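import Summits.QuantumFields.YangMills.Theorems.UnitScaleTiltProp7RowPOfFaceFluxRows
import HarnessLib

/-!
# Route `UnitScaleTilt`, crux K1 «MinimiserStabilityRegPr» (stmt-QuantumFields-19200), route-R E′ S3 — ROW (P) KNIT WITH THE FACE FUNCTIONAL OF THE GAUSS CHAIN ARBITRARY
# (✓`Prop7RowPOfFaceFluxRows.rowP_of_faceFluxRows` with its step (4), the (E)-row, DISPLAYED instead of instantiated at the per-line face functional)

Cell `ym3-torus`, width seat `ym3-torus-px5` (gen 3), 2026-08-29; «cure (b)» of px15's LOCATE-HXB-SPLIT-px15g3.md §0.2, first half (the member at the comb-direct face functional is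
`Prop7RowPOfCombFaceFluxRows`).  THEOREMS ONLY (0 `def`, 0 `sorry`); `--supports stmt-QuantumFields-19200 --as helper`, count-neutral; ✓p680744 untouched (new file).  YM₃ on T³ is a
ladder rung (R3), not the Clay problem; nothing here claims the stub, the crux, d = 4 or the mass gap; the rows `hXb`, `hq`, `hE` are DISPLAYED, not proved.
WHY.  px15's exact split of the Gauss composite (BLOCK-GAUSS ✓p680339∕✓p680975, INT-PAIRING ✓p681851, INT-CS ✓p682982, INT-TRANSPORT ✓p684144) pairs the centre differences with the
COMB-DIRECT face functional `FACE′`, not with ✓p680744's per-line `FACE` (against which a face-defect piece costing a `δ^V` slot appears); other Gauss-chain variants may want yet another face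
letter.  So the knit is re-run with `FACE : PBond (K−n) → M₂(ℂ)` ARBITRARY and its (E)-row ▢ `hE : Σ_c‖LINE_c − FACE_c‖² ≤ C_E·ℓ·G_W(B) + θ_E·e·ℓ⁻¹·M` DISPLAYED in (P)'s currencies (LINE = the
per-line covariant block functional of ✓p680744's `hL` step, centre frame): ★★ `rowP_of_faceFluxRows_of_hE`, output ROW (P′) of the R5 door ✓`Prop7ZetaRowOfEngineRowsAbs` at
`(ζ_P∕θ′, θ′, θ_P, C_P, C_Λ, η) := (ζ_X∕θ, θ + θ_q, θ_X + 64(C_G+C_S²) + 768·10⁹L⁹ + 8θ_E, C_X + 8C_E, 19200L⁴, η_X + η_q)`.  Proof = ✓p680744's steps (1)–(3), (5)–(7) verbatim (R2′ ✓p666871,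
reduced-vs-engine defect ✓p679745 at `2e`, px17's R3′ door ✓p669468 with `Elong := C_E·ℓ·G_W + θ_E·e·ℓ⁻¹·M`, `Σ‖B‖² ≤ 2M` ✓p670866-class bookkeeping); ✓p680744 is the member `C_E = 1`, `θ_E = 0`.
HONEST SCOPE.  Composition of landed theorems; `hXb`, `hq`, `hE` are INPUTS; constants crude, `L`-only; no estimate of Bałaban's is asserted.
References: T. Bałaban, CMP 102 (1985) 277–309 [Balaban1985Variational] ((6) p.278, (141)–(143) p.299, Prop. 7 p.299); CMP 99 (1985) 389–434 [Balaban1985BackgroundPropagators] ((3.3) p.390,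
(3.8)–(3.10) p.392, (3.117)–(3.122) pp.419–420, Thm 3.11 p.416); CMP 95 (1984) 17–40 [Balaban1984PropagatorsI] ((1.18)–(1.21) pp.19–21, Prop. 1.1 (1.90) p.33); CMP 98 (1985) 17–51
[Balaban1985Averaging] ((11) p.19, Prop. 2 (53) p.26, Prop. 3 (124)–(126) p.36).
-/

set_option autoImplicit false

noncomputable section

open scoped BigOperators Matrix.Norms.L2Operator Matrix

namespace Summit.QuantumFields.YangMills.Theorems.Prop7RowPOfFaceFluxRowsOfHE
open Literature.MathematicalPhysics.QuantumFieldTheory.Balaban1983to89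
open Literature.MathematicalPhysics.QuantumFieldTheory.Balaban1983to89.T3ContinuumYM3Torus
open Finset T4Continuum T4ReflectionCone BlockAveraging AveragingRT ExpMeanLog BlockAveragingEMLLinearised BlockAveragingEMLLinearisedBackground
  BlockAveragingEMLProp2 B1RG242Torus
open B15DeterminingSets (embIter)
open B7Prop1Explicit (U1 treeWord)
open B7Eq78Linearization (conjR)
open B9Eq39Adjoint (covD divB curl)
open B9TorusCalculus (torusT)
open B10Eq27TorusAxialLog (holT unitsField toUField holT_nil holT_cons_true holT_cons_false)
open Summit.QuantumFields.YangMills.Theorems.Prop7CovIterLambdaBound (plaqSmall_of_le_of_lt)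
open Summit.QuantumFields.YangMills.Theorems.Prop7CurvedLandauKnitT3 (smallness_T3 three_le_L)
open Summit.QuantumFields.YangMills.Theorems.Prop7CurvedLandauRowA (exists_reduced_family exists_coarseGauge_family)
open Summit.QuantumFields.YangMills.Theorems.Prop7LineIterVsEngineOfTower (exists_pureLine_family)
open Summit.QuantumFields.YangMills.Theorems.Prop7CovConstraintSplitOfRegPr (covConstraintSplit_coclosed_T3)
open Summit.QuantumFields.YangMills.Theorems.Prop7DefBookingEM (sum_normSq_reduced_sub_engine_le_of_tower)
open Summit.QuantumFields.YangMills.Theorems.Prop7CovFaceFluxRow (sum_normSq_centreDiff_le_of_rows)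
open Summit.QuantumFields.YangMills.Theorems.Prop7CoclosedEnergiesOfHKgK (sum_norm_sq_le_of_coclosed_split)
open Summit.QuantumFields.YangMills.Theorems.Prop7CovCombMeanFrames (conjR_bond_su)


open Summit.QuantumFields.YangMills.Theorems.Prop7RowPOfFaceFluxRows (real_smul_eq_coe_smul)

/-! ## ★★ ROW (P) of the R5 door with the face functional arbitrary and its (E)-row displayed -/

set_option maxHeartbeats 400000 in
/-- ★★ **ROW (P) KNIT, FACE FUNCTIONAL ARBITRARY.**  Member of a T³ family (`N = 2`, `d = 3`), level `K − n`, `ℓ = L^{K−n}`; background `W` with `dist1(W(∂p)) ≤ e·ℓ⁻²`, `0 < e`,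
`10⁶L⁵e ≤ 1`; a co-closed covariant Hodge split `D = B + D_Wφ₀`; the true linearised iterate `Q` displayed by its recursion; a face functional `FACE` of the Gauss chain (ARBITRARY).
DISPLAYED ROWS: `hq` — `8·Σ_c‖Q^{(K−n)}D(c)‖² ≤ θ_q·ℓ⁻¹·M + η_q·ℓ·DIV(D)`; `hE` — the (E)-row `Σ_c‖LINE_c − FACE_c‖² ≤ C_E·ℓ·G_W(B) + θ_E·e·ℓ⁻¹·M` (LINE = the per-line covariant block functional of `B`,
centre frame); `hXb` — the Gauss composite `2|Σ_c Re tr((φ₀(c₋) − W̄(c)φ₀(c₊)W̄(c)*)ᴴ·FACE_c)| ≤ ℓ(ζ_X∕θ)K + θℓ⁻¹M + θ_X·e·ℓ⁻¹M + C_X·ℓ·G_W(B) + η_X·ℓ·DIV(D)`.  CONCLUSION = ROW (P′) of the R5 door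
✓`Prop7ZetaRowOfEngineRowsAbs` at `(ζ_P∕θ′, θ′, θ_P, C_P, C_Λ, η) := (ζ_X∕θ, θ + θ_q, θ_X + 64(C_G+C_S²) + 768·10⁹L⁹ + 8θ_E, C_X + 8C_E, 19200L⁴, η_X + η_q)`.  (✓p680744 is the member
`FACE :=` per-line face functional, `C_E = 1`, `θ_E = 0`.)
[cite: Balaban1985Variational, (6) p.278, (141)-(143) p.299, Prop. 7 p.299; Balaban1985BackgroundPropagators, (3.8)-(3.10) p.392, (3.117)-(3.122) pp.419-420, Thm 3.11 p.416; Balaban1984PropagatorsI, (1.18)-(1.21) pp.19-21, Prop. 1.1 (1.90) p.33; Balaban1985Averaging, (11) p.19, Prop. 2 (53) p.26] -/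
theorem rowP_of_faceFluxRows_of_hE (F : T3Family) (n K : ℕ) (W : GaugeField (F.P K) 0 (Matrix.specialUnitaryGroup (Fin 2) ℂ))
    {e θ ζ_X θ_X C_X η_X θ_q η_q : ℝ} (he : 0 < e) (heL : 1000000 * (F.L : ℝ) ^ 5 * e ≤ 1)
    (hW : ∀ p : Plaq (F.P K) 0, dist1 (GaugeField.plaqHol W p) ≤ e * (((F.L : ℝ) ^ (K - n)) ^ 2)⁻¹)
    (D B : PBond (F.P K) 0 → Matrix (Fin 2) (Fin 2) ℂ) (φ₀ : Site (F.P K) 0 → Matrix (Fin 2) (Fin 2) ℂ)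
    (hsplit : ∀ b : PBond (F.P K) 0, D b = B b + covD (torusT (F.P K) 0) (fun κ z => unitsField (toUField W) ⟨z, κ⟩) b.dir φ₀ b.src)
    (hBc : ∀ x : Site (F.P K) 0, divB (torusT (F.P K) 0) (fun κ z => unitsField (toUField W) ⟨z, κ⟩) (fun κ z => B ⟨z, κ⟩) x = 0)
    -- the true linearised iterate of record, displayed by its recursion (✓`exists_trueLinIter_family`)
    (Q : (k : ℕ) → (PBond (F.P K) 0 → Matrix (Fin 2) (Fin 2) ℂ) → PBond (F.P K) k → Matrix (Fin 2) (Fin 2) ℂ) (hQ0 : ∀ Y, Q 0 Y = Y)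
    (hQs : ∀ (k : ℕ) (Y : PBond (F.P K) 0 → Matrix (Fin 2) (Fin 2) ℂ) (c : PBond (F.P K) (k + 1)), Q (k + 1) Y c
      = fderiv ℂ (eml : (Idx (F.P K) → Matrix (Fin 2) (Fin 2) ℂ) → Matrix (Fin 2) (Fin 2) ℂ)
            (fun i => ((loopHol (Averaging.iter (fun i => blockAvg (P := F.P K) (j := i) (expMeanLogSU (n := Fin 2))) k W) c i :
              Matrix.specialUnitaryGroup (Fin 2) ℂ) : Matrix (Fin 2) (Fin 2) ℂ))
            (fun i => covWalkSum (Averaging.iter (fun i => blockAvg (P := F.P K) (j := i) (expMeanLogSU (n := Fin 2))) k W) (Q k Y)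
                (walk (emb c.src) (loopWord (F.P K).L c.dir (off i.1) i.2.1 i.2.2))
              * ((loopHol (Averaging.iter (fun i => blockAvg (P := F.P K) (j := i) (expMeanLogSU (n := Fin 2))) k W) c i :
                Matrix.specialUnitaryGroup (Fin 2) ℂ) : Matrix (Fin 2) (Fin 2) ℂ))
            * star ((corr (expMeanLogSU (n := Fin 2)) (Averaging.iter (fun i => blockAvg (P := F.P K) (j := i) (expMeanLogSU (n := Fin 2))) k W) c :
                Matrix.specialUnitaryGroup (Fin 2) ℂ) : Matrix (Fin 2) (Fin 2) ℂ)
          + ((corr (expMeanLogSU (n := Fin 2)) (Averaging.iter (fun i => blockAvg (P := F.P K) (j := i) (expMeanLogSU (n := Fin 2))) k W) c :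
                Matrix.specialUnitaryGroup (Fin 2) ℂ) : Matrix (Fin 2) (Fin 2) ℂ)
            * covWalkSum (Averaging.iter (fun i => blockAvg (P := F.P K) (j := i) (expMeanLogSU (n := Fin 2))) k W) (Q k Y)
                (walk (emb c.src) (List.replicate (F.P K).L (c.dir, true)))
            * star ((corr (expMeanLogSU (n := Fin 2)) (Averaging.iter (fun i => blockAvg (P := F.P K) (j := i) (expMeanLogSU (n := Fin 2))) k W) c :
                Matrix.specialUnitaryGroup (Fin 2) ℂ) : Matrix (Fin 2) (Fin 2) ℂ))
    -- ▢ hq — THE FIBRE-DEFECT ROW (pointwise second order along the averaging paths; routeR-w2): `8·Σ_c‖Q^{(K−n)}D(c)‖² ≤ θ_q·ℓ⁻¹·M + η_q·ℓ·DIV(D)`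
    (hq : 8 * ∑ c : PBond (F.P K) (K - n), ‖Q (K - n) D c‖ ^ 2 ≤ θ_q * ((F.L : ℝ) ^ (K - n))⁻¹ * (∑ b : PBond (F.P K) 0, ‖D b‖ ^ 2)
        + η_q * ((F.L : ℝ) ^ (K - n)) * (∑ x : Site (F.P K) 0, ∑ j : Fin 2, ∑ k : Fin 2,
              ‖(divB (torusT (F.P K) 0) (fun κ z => unitsField (toUField W) ⟨z, κ⟩) (fun κ z => Complex.I • D ⟨z, κ⟩) x) j k‖ ^ 2))
    -- the FACE FUNCTIONAL of the Gauss chain (arbitrary) and ▢ hE — its (E)-row `Σ_c‖LINE_c − FACE_c‖² ≤ C_E·ℓ·G_W(B) + θ_E·e·ℓ⁻¹·M` DISPLAYED in (P)'s currencies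
    (FACE : PBond (F.P K) (K - n) → Matrix (Fin 2) (Fin 2) ℂ) {C_E θ_E : ℝ}
    (hE : ∑ c : PBond (F.P K) (K - n), ‖((((F.P K).L : ℝ) ^ (K - n)) ^ (F.P K).d)⁻¹ • ((((holAt W (walk (embIter (K - n) c.src) (treeWord fun _ : Fin (F.P K).d => -((((F.P K).L ^ (K - n) - 1) / 2 : ℕ) : ℤ))) : Matrix.specialUnitaryGroup (Fin 2) ℂ) : Matrix (Fin 2) (Fin 2) ℂ))
          * (∑ r : Fin (F.P K).d → Fin ((F.P K).L ^ (K - n)), ∑ s ∈ Finset.range ((F.P K).L ^ (K - n)),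
              conjR (holT (unitsField (toUField W)) (Site.fibreSite 0 (K - n) c.src fun _ => ⟨0, pow_pos (F.P K).L_pos (K - n)⟩) (treeWord fun ν => ((r ν : ℕ) : ℤ))
                  * holT (unitsField (toUField W)) (Site.fibreSite 0 (K - n) c.src r) (List.replicate s (c.dir, true)))
                (B ⟨(fun z : Site (F.P K) 0 => z.shift c.dir)^[s] (Site.fibreSite 0 (K - n) c.src r), c.dir⟩))
          * star (((holAt W (walk (embIter (K - n) c.src) (treeWord fun _ : Fin (F.P K).d => -((((F.P K).L ^ (K - n) - 1) / 2 : ℕ) : ℤ))) : Matrix.specialUnitaryGroup (Fin 2) ℂ) : Matrix (Fin 2) (Fin 2) ℂ))) - FACE c‖ ^ 2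
      ≤ C_E * ((F.L : ℝ) ^ (K - n)) * (∑ b : PBond (F.P K) 0, ∑ ν : Fin (F.P K).d,
                ‖((W ⟨b.src, ν⟩ : Matrix.specialUnitaryGroup (Fin 2) ℂ) : Matrix (Fin 2) (Fin 2) ℂ) * B ⟨b.src.shift ν, b.dir⟩ * star ((W ⟨b.src, ν⟩ : Matrix.specialUnitaryGroup (Fin 2) ℂ) : Matrix (Fin 2) (Fin 2) ℂ) - B b‖ ^ 2)
        + θ_E * e * ((F.L : ℝ) ^ (K - n))⁻¹ * (∑ b : PBond (F.P K) 0, ‖D b‖ ^ 2))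
    -- ▢ hXb — THE GAUSS COMPOSITE against that FACE, in (P) currencies
    (hXb : 2 * |∑ c : PBond (F.P K) (K - n), (((φ₀ (embIter (K - n) c.src)
          - ((Averaging.iter (fun i => blockAvg (P := F.P K) (j := i) (expMeanLogSU (n := Fin 2))) (K - n) W c : Matrix.specialUnitaryGroup (Fin 2) ℂ) : Matrix (Fin 2) (Fin 2) ℂ)
              * φ₀ (embIter (K - n) c.tgt)
              * star ((Averaging.iter (fun i => blockAvg (P := F.P K) (j := i) (expMeanLogSU (n := Fin 2))) (K - n) W c : Matrix.specialUnitaryGroup (Fin 2) ℂ) : Matrix (Fin 2) (Fin 2) ℂ))ᴴ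
          * FACE c).trace).re|
      ≤ ((F.L : ℝ) ^ (K - n)) * (ζ_X / θ) * (∑ p : Plaq (F.P K) 0, ‖((Complex.I • D ⟨p.src, p.μ⟩) + ((W ⟨p.src, p.μ⟩ : Matrix (Fin 2) (Fin 2) ℂ) * (Complex.I • D ⟨p.src.shift p.μ, p.ν⟩) * star (W ⟨p.src, p.μ⟩ : Matrix (Fin 2) (Fin 2) ℂ))
            - (((W ⟨p.src, p.μ⟩ * W ⟨p.src.shift p.μ, p.ν⟩ * (W ⟨p.src.shift p.ν, p.μ⟩)⁻¹ : Matrix.specialUnitaryGroup (Fin 2) ℂ) : Matrix (Fin 2) (Fin 2) ℂ) * (Complex.I • D ⟨p.src.shift p.ν, p.μ⟩) * star ((W ⟨p.src, p.μ⟩ * W ⟨p.src.shift p.μ, p.ν⟩ * (W ⟨p.src.shift p.ν, p.μ⟩)⁻¹ : Matrix.specialUnitaryGroup (Fin 2) ℂ) : Matrix (Fin 2) (Fin 2) ℂ))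
            - (((GaugeField.plaqHol W p : Matrix.specialUnitaryGroup (Fin 2) ℂ) : Matrix (Fin 2) (Fin 2) ℂ) * (Complex.I • D ⟨p.src, p.ν⟩) * star ((GaugeField.plaqHol W p : Matrix.specialUnitaryGroup (Fin 2) ℂ) : Matrix (Fin 2) (Fin 2) ℂ)))‖ ^ 2)
        + θ * ((F.L : ℝ) ^ (K - n))⁻¹ * (∑ b : PBond (F.P K) 0, ‖D b‖ ^ 2)
        + θ_X * e * ((F.L : ℝ) ^ (K - n))⁻¹ * (∑ b : PBond (F.P K) 0, ‖D b‖ ^ 2)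
        + C_X * ((F.L : ℝ) ^ (K - n)) * (∑ b : PBond (F.P K) 0, ∑ ν : Fin (F.P K).d,
                ‖((W ⟨b.src, ν⟩ : Matrix.specialUnitaryGroup (Fin 2) ℂ) : Matrix (Fin 2) (Fin 2) ℂ) * B ⟨b.src.shift ν, b.dir⟩ * star ((W ⟨b.src, ν⟩ : Matrix.specialUnitaryGroup (Fin 2) ℂ) : Matrix (Fin 2) (Fin 2) ℂ) - B b‖ ^ 2)
        + η_X * ((F.L : ℝ) ^ (K - n)) * (∑ x : Site (F.P K) 0, ∑ j : Fin 2, ∑ k : Fin 2,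
              ‖(divB (torusT (F.P K) 0) (fun κ z => unitsField (toUField W) ⟨z, κ⟩) (fun κ z => Complex.I • D ⟨z, κ⟩) x) j k‖ ^ 2)) :
    (∑ c : PBond (F.P K) (K - n), ∑ a : Fin 2, ∑ b : Fin 2,
        Complex.normSq ((φ₀ (embIter (K - n) c.src) - ((Averaging.iter (fun i => blockAvg (P := F.P K) (j := i) (expMeanLogSU (n := Fin 2))) (K - n) W c : Matrix.specialUnitaryGroup (Fin 2) ℂ) : Matrix (Fin 2) (Fin 2) ℂ)
            * φ₀ (embIter (K - n) c.tgt) * star ((Averaging.iter (fun i => blockAvg (P := F.P K) (j := i) (expMeanLogSU (n := Fin 2))) (K - n) W c : Matrix.specialUnitaryGroup (Fin 2) ℂ) : Matrix (Fin 2) (Fin 2) ℂ)) a b))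
      ≤ ((F.L : ℝ) ^ (K - n)) * (ζ_X / θ) * (∑ p : Plaq (F.P K) 0, ‖((Complex.I • D ⟨p.src, p.μ⟩) + ((W ⟨p.src, p.μ⟩ : Matrix (Fin 2) (Fin 2) ℂ) * (Complex.I • D ⟨p.src.shift p.μ, p.ν⟩) * star (W ⟨p.src, p.μ⟩ : Matrix (Fin 2) (Fin 2) ℂ))
            - (((W ⟨p.src, p.μ⟩ * W ⟨p.src.shift p.μ, p.ν⟩ * (W ⟨p.src.shift p.ν, p.μ⟩)⁻¹ : Matrix.specialUnitaryGroup (Fin 2) ℂ) : Matrix (Fin 2) (Fin 2) ℂ) * (Complex.I • D ⟨p.src.shift p.ν, p.μ⟩) * star ((W ⟨p.src, p.μ⟩ * W ⟨p.src.shift p.μ, p.ν⟩ * (W ⟨p.src.shift p.ν, p.μ⟩)⁻¹ : Matrix.specialUnitaryGroup (Fin 2) ℂ) : Matrix (Fin 2) (Fin 2) ℂ))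
            - (((GaugeField.plaqHol W p : Matrix.specialUnitaryGroup (Fin 2) ℂ) : Matrix (Fin 2) (Fin 2) ℂ) * (Complex.I • D ⟨p.src, p.ν⟩) * star ((GaugeField.plaqHol W p : Matrix.specialUnitaryGroup (Fin 2) ℂ) : Matrix (Fin 2) (Fin 2) ℂ)))‖ ^ 2)
        + (θ + θ_q) * ((F.L : ℝ) ^ (K - n))⁻¹ * (∑ b : PBond (F.P K) 0, ‖D b‖ ^ 2)
        + (θ_X + 64 * ((4770 * (F.L : ℝ) ^ 3) ^ 2 * ((5 * (F.L : ℝ)) ^ 2 / 2) ^ 2 / 4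
              + (2 * (5 * (F.L : ℝ)) ^ 3 / ((F.L : ℝ) * ((F.L : ℝ) - 1) * ((F.L : ℝ) ^ 2 - 1)) + (2 * (5 * (F.L : ℝ)) + 2 * 3 + 1) ^ 2 / 2) ^ 2)
              + 768000000000 * (F.L : ℝ) ^ 9 + 8 * θ_E) * e * ((F.L : ℝ) ^ (K - n))⁻¹ * (∑ b : PBond (F.P K) 0, ‖D b‖ ^ 2)
        + (C_X + 8 * C_E) * ((F.L : ℝ) ^ (K - n)) * (∑ b : PBond (F.P K) 0, ∑ ν : Fin (F.P K).d,
                ‖((W ⟨b.src, ν⟩ : Matrix.specialUnitaryGroup (Fin 2) ℂ) : Matrix (Fin 2) (Fin 2) ℂ) * B ⟨b.src.shift ν, b.dir⟩ * star ((W ⟨b.src, ν⟩ : Matrix.specialUnitaryGroup (Fin 2) ℂ) : Matrix (Fin 2) (Fin 2) ℂ) - B b‖ ^ 2)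
        + 19200 * (F.L : ℝ) ^ 4 * ((F.L : ℝ) ^ (K - n)) * (∑ x : Site (F.P K) 0, ∑ μ : Fin (F.P K).d, ∑ ν : Fin (F.P K).d,
                (if μ < ν then ∑ j : Fin 2, ∑ k : Fin 2, ‖(curl (torusT (F.P K) 0) (fun κ z => unitsField (toUField W) ⟨z, κ⟩) (fun κ z => B ⟨z, κ⟩) μ ν x) j k‖ ^ 2 else 0))
        + (η_X + η_q) * ((F.L : ℝ) ^ (K - n)) * (∑ x : Site (F.P K) 0, ∑ j : Fin 2, ∑ k : Fin 2,
              ‖(divB (torusT (F.P K) 0) (fun κ z => unitsField (toUField W) ⟨z, κ⟩) (fun κ z => Complex.I • D ⟨z, κ⟩) x) j k‖ ^ 2) := by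
  -- ===== member arithmetic letters =====
  have hd : (F.P K).d = 3 := T3Family.P_d F K
  have hLF : (F.P K).L = F.L := rfl
  have hL3 := three_le_L F
  have hLpos : (0 : ℝ) < (F.L : ℝ) := by linarith
  have hℓ : (0 : ℝ) < (F.L : ℝ) ^ (K - n) := pow_pos hLpos _
  have hk : K - n ≤ (F.P K).m + (F.P K).K := by show K - n ≤ F.m + K; omega
  have he1 : e ≤ 1 := by
    have h5 : (1 : ℝ) ≤ (F.L : ℝ) ^ 5 := one_le_pow₀ (by linarith)
    nlinarith
  have h2e1 : 2 * e ≤ 1 := by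
    have h5 : (3 : ℝ) ^ 5 ≤ (F.L : ℝ) ^ 5 := pow_le_pow_left₀ (by norm_num) hL3 5
    nlinarith
  -- ===== names for the energies =====
  set KD : ℝ := (∑ p : Plaq (F.P K) 0, ‖((Complex.I • D ⟨p.src, p.μ⟩) + ((W ⟨p.src, p.μ⟩ : Matrix (Fin 2) (Fin 2) ℂ) * (Complex.I • D ⟨p.src.shift p.μ, p.ν⟩) * star (W ⟨p.src, p.μ⟩ : Matrix (Fin 2) (Fin 2) ℂ))
            - (((W ⟨p.src, p.μ⟩ * W ⟨p.src.shift p.μ, p.ν⟩ * (W ⟨p.src.shift p.ν, p.μ⟩)⁻¹ : Matrix.specialUnitaryGroup (Fin 2) ℂ) : Matrix (Fin 2) (Fin 2) ℂ) * (Complex.I • D ⟨p.src.shift p.ν, p.μ⟩) * star ((W ⟨p.src, p.μ⟩ * W ⟨p.src.shift p.μ, p.ν⟩ * (W ⟨p.src.shift p.ν, p.μ⟩)⁻¹ : Matrix.specialUnitaryGroup (Fin 2) ℂ) : Matrix (Fin 2) (Fin 2) ℂ))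
            - (((GaugeField.plaqHol W p : Matrix.specialUnitaryGroup (Fin 2) ℂ) : Matrix (Fin 2) (Fin 2) ℂ) * (Complex.I • D ⟨p.src, p.ν⟩) * star ((GaugeField.plaqHol W p : Matrix.specialUnitaryGroup (Fin 2) ℂ) : Matrix (Fin 2) (Fin 2) ℂ)))‖ ^ 2) with hKD
  set MD : ℝ := (∑ b : PBond (F.P K) 0, ‖D b‖ ^ 2) with hMD
  set MB : ℝ := (∑ b : PBond (F.P K) 0, ‖B b‖ ^ 2) with hMB
  set GW : ℝ := (∑ b : PBond (F.P K) 0, ∑ ν : Fin (F.P K).d,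
                ‖((W ⟨b.src, ν⟩ : Matrix.specialUnitaryGroup (Fin 2) ℂ) : Matrix (Fin 2) (Fin 2) ℂ) * B ⟨b.src.shift ν, b.dir⟩ * star ((W ⟨b.src, ν⟩ : Matrix.specialUnitaryGroup (Fin 2) ℂ) : Matrix (Fin 2) (Fin 2) ℂ) - B b‖ ^ 2) with hGW
  set CURL : ℝ := (∑ x : Site (F.P K) 0, ∑ μ : Fin (F.P K).d, ∑ ν : Fin (F.P K).d,
                (if μ < ν then ∑ j : Fin 2, ∑ k : Fin 2, ‖(curl (torusT (F.P K) 0) (fun κ z => unitsField (toUField W) ⟨z, κ⟩) (fun κ z => B ⟨z, κ⟩) μ ν x) j k‖ ^ 2 else 0)) with hCURL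
  set DIV : ℝ := (∑ x : Site (F.P K) 0, ∑ j : Fin 2, ∑ k : Fin 2,
              ‖(divB (torusT (F.P K) 0) (fun κ z => unitsField (toUField W) ⟨z, κ⟩) (fun κ z => Complex.I • D ⟨z, κ⟩) x) j k‖ ^ 2) with hDIV
  have hMD0 : 0 ≤ MD := Finset.sum_nonneg fun _ _ => sq_nonneg _
  have hMB0 : 0 ≤ MB := Finset.sum_nonneg fun _ _ => sq_nonneg _
  have hGW0 : 0 ≤ GW := Finset.sum_nonneg fun _ _ => Finset.sum_nonneg fun _ _ => sq_nonneg _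
  have hKD0 : 0 ≤ KD := Finset.sum_nonneg fun _ _ => sq_nonneg _
  have hBM : MB ≤ 2 * MD := by
    have h := sum_norm_sq_le_of_coclosed_split (N := 2) W D B φ₀ hsplit hBc
    simpa only [Nat.cast_ofNat] using h
  -- ===== (1) the families of `B` =====
  obtain ⟨G, hG0, hGs⟩ := exists_reduced_family (P := F.P K) (N := 2) W B
  obtain ⟨S, hS0, hSs⟩ := exists_pureLine_family (P := F.P K) W B
  obtain ⟨Λ, hΛ0, hΛs⟩ := exists_coarseGauge_family (P := F.P K) (N := 2) W G
  -- ===== (2) R2′: the door's identity and the Λ-row =====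
  obtain ⟨hR2, hΛb⟩ := covConstraintSplit_coclosed_T3 F n K W he heL hW Q hQ0 hQs D B φ₀ hsplit hBc G S Λ hΛ0 hG0 hS0 hΛs hGs hSs
  -- ===== (3) the reduced-vs-engine defect at `2e`, d = 3 reading =====
  obtain ⟨-, hε3, hε2, hε24, hεκ⟩ := smallness_T3 F K he heL
  have hε' : 0 < 2 * e := by linarith only [he]
  have hU' : PlaqSmall (2 * e * ((((F.P K).L : ℝ) ^ (K - n))⁻¹) ^ 2) W := by
    refine plaqSmall_of_le_of_lt hW ?_
    rw [hLF, inv_pow]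
    exact mul_lt_mul_of_pos_right (by linarith only [he]) (inv_pos.mpr (by positivity))
  have h8 := Prop7DefBookingEM.def_booking_eM_d3 hk W B G S hG0 hS0 hGs hSs hε' hε3 hε2 hε24 hU' hd hεκ h2e1 hMD0 hBM
  -- the constant of ✓RowE at `d = 3`, `L := F.L`
  have eC : ((318 * (F.P K).d * (((F.P K).d : ℝ) + 2) * ((F.P K).L : ℝ) ^ (F.P K).d) ^ 2 * (((((F.P K).d + 2) * (F.P K).L : ℕ) : ℝ) ^ 2 / 2) ^ 2 / 4
              + (2 * ((((F.P K).d + 2) * (F.P K).L : ℕ) : ℝ) ^ 3 / (((F.P K).L : ℝ) * (((F.P K).L : ℝ) - 1) * (((F.P K).L : ℝ) ^ 2 - 1))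
                  + ((2 * ((((F.P K).d + 2) * (F.P K).L : ℕ) : ℝ) + 2 * (F.P K).d + 1)) ^ 2 / 2) ^ 2)
      = ((4770 * (F.L : ℝ) ^ 3) ^ 2 * ((5 * (F.L : ℝ)) ^ 2 / 2) ^ 2 / 4
              + (2 * (5 * (F.L : ℝ)) ^ 3 / ((F.L : ℝ) * ((F.L : ℝ) - 1) * ((F.L : ℝ) ^ 2 - 1)) + (2 * (5 * (F.L : ℝ)) + 2 * 3 + 1) ^ 2 / 2) ^ 2) := by
    rw [hd]; simp only [hLF]; push_cast; ring
  have hGX : 4 * (2 : ℝ) * ∑ c : PBond (F.P K) (K - n), ‖G (K - n) c - ((((F.P K).L : ℂ) ^ (K - n)) ^ (F.P K).d)⁻¹ • ((((holAt W (walk (embIter (K - n) c.src) (treeWord fun _ : Fin (F.P K).d => -((((F.P K).L ^ (K - n) - 1) / 2 : ℕ) : ℤ))) : Matrix.specialUnitaryGroup (Fin 2) ℂ) : Matrix (Fin 2) (Fin 2) ℂ))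
          * (∑ r : Fin (F.P K).d → Fin ((F.P K).L ^ (K - n)), ∑ s ∈ Finset.range ((F.P K).L ^ (K - n)),
              conjR (holT (unitsField (toUField W)) (Site.fibreSite 0 (K - n) c.src fun _ => ⟨0, pow_pos (F.P K).L_pos (K - n)⟩) (treeWord fun ν => ((r ν : ℕ) : ℤ))
                  * holT (unitsField (toUField W)) (Site.fibreSite 0 (K - n) c.src r) (List.replicate s (c.dir, true)))
                (B ⟨(fun z : Site (F.P K) 0 => z.shift c.dir)^[s] (Site.fibreSite 0 (K - n) c.src r), c.dir⟩))
          * star (((holAt W (walk (embIter (K - n) c.src) (treeWord fun _ : Fin (F.P K).d => -((((F.P K).L ^ (K - n) - 1) / 2 : ℕ) : ℤ))) : Matrix.specialUnitaryGroup (Fin 2) ℂ) : Matrix (Fin 2) (Fin 2) ℂ)))‖ ^ 2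
      ≤ 64 * ((4770 * (F.L : ℝ) ^ 3) ^ 2 * ((5 * (F.L : ℝ)) ^ 2 / 2) ^ 2 / 4
              + (2 * (5 * (F.L : ℝ)) ^ 3 / ((F.L : ℝ) * ((F.L : ℝ) - 1) * ((F.L : ℝ) ^ 2 - 1)) + (2 * (5 * (F.L : ℝ)) + 2 * 3 + 1) ^ 2 / 2) ^ 2) * e * ((F.L : ℝ) ^ (K - n))⁻¹ * MD := by
    have h := h8
    rw [eC] at h
    simp only [hLF, Nat.cast_ofNat] at h
    refine h.trans (le_of_eq ?_)
    ring
  -- the seam `LINE_ℝ = X_ℂ`, and the door's `hL` in final currency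
  have hscal : ((((((F.P K).L : ℝ) ^ (K - n)) ^ (F.P K).d)⁻¹ : ℝ) : ℂ) = ((((F.P K).L : ℂ) ^ (K - n)) ^ (F.P K).d)⁻¹ := by push_cast; ring
  have hL : ∑ c : PBond (F.P K) (K - n), ‖G (K - n) c - ((((F.P K).L : ℝ) ^ (K - n)) ^ (F.P K).d)⁻¹ • ((((holAt W (walk (embIter (K - n) c.src) (treeWord fun _ : Fin (F.P K).d => -((((F.P K).L ^ (K - n) - 1) / 2 : ℕ) : ℤ))) : Matrix.specialUnitaryGroup (Fin 2) ℂ) : Matrix (Fin 2) (Fin 2) ℂ))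
          * (∑ r : Fin (F.P K).d → Fin ((F.P K).L ^ (K - n)), ∑ s ∈ Finset.range ((F.P K).L ^ (K - n)),
              conjR (holT (unitsField (toUField W)) (Site.fibreSite 0 (K - n) c.src fun _ => ⟨0, pow_pos (F.P K).L_pos (K - n)⟩) (treeWord fun ν => ((r ν : ℕ) : ℤ))
                  * holT (unitsField (toUField W)) (Site.fibreSite 0 (K - n) c.src r) (List.replicate s (c.dir, true)))
                (B ⟨(fun z : Site (F.P K) 0 => z.shift c.dir)^[s] (Site.fibreSite 0 (K - n) c.src r), c.dir⟩))
          * star (((holAt W (walk (embIter (K - n) c.src) (treeWord fun _ : Fin (F.P K).d => -((((F.P K).L ^ (K - n) - 1) / 2 : ℕ) : ℤ))) : Matrix.specialUnitaryGroup (Fin 2) ℂ) : Matrix (Fin 2) (Fin 2) ℂ)))‖ ^ 2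
      ≤ 8 * ((4770 * (F.L : ℝ) ^ 3) ^ 2 * ((5 * (F.L : ℝ)) ^ 2 / 2) ^ 2 / 4
              + (2 * (5 * (F.L : ℝ)) ^ 3 / ((F.L : ℝ) * ((F.L : ℝ) - 1) * ((F.L : ℝ) ^ 2 - 1)) + (2 * (5 * (F.L : ℝ)) + 2 * 3 + 1) ^ 2 / 2) ^ 2) * e * ((F.L : ℝ) ^ (K - n))⁻¹ * MD := by
    have hconv : ∑ c : PBond (F.P K) (K - n), ‖G (K - n) c - ((((F.P K).L : ℝ) ^ (K - n)) ^ (F.P K).d)⁻¹ • ((((holAt W (walk (embIter (K - n) c.src) (treeWord fun _ : Fin (F.P K).d => -((((F.P K).L ^ (K - n) - 1) / 2 : ℕ) : ℤ))) : Matrix.specialUnitaryGroup (Fin 2) ℂ) : Matrix (Fin 2) (Fin 2) ℂ))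
          * (∑ r : Fin (F.P K).d → Fin ((F.P K).L ^ (K - n)), ∑ s ∈ Finset.range ((F.P K).L ^ (K - n)),
              conjR (holT (unitsField (toUField W)) (Site.fibreSite 0 (K - n) c.src fun _ => ⟨0, pow_pos (F.P K).L_pos (K - n)⟩) (treeWord fun ν => ((r ν : ℕ) : ℤ))
                  * holT (unitsField (toUField W)) (Site.fibreSite 0 (K - n) c.src r) (List.replicate s (c.dir, true)))
                (B ⟨(fun z : Site (F.P K) 0 => z.shift c.dir)^[s] (Site.fibreSite 0 (K - n) c.src r), c.dir⟩))
          * star (((holAt W (walk (embIter (K - n) c.src) (treeWord fun _ : Fin (F.P K).d => -((((F.P K).L ^ (K - n) - 1) / 2 : ℕ) : ℤ))) : Matrix.specialUnitaryGroup (Fin 2) ℂ) : Matrix (Fin 2) (Fin 2) ℂ)))‖ ^ 2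
        = ∑ c : PBond (F.P K) (K - n), ‖G (K - n) c - ((((F.P K).L : ℂ) ^ (K - n)) ^ (F.P K).d)⁻¹ • ((((holAt W (walk (embIter (K - n) c.src) (treeWord fun _ : Fin (F.P K).d => -((((F.P K).L ^ (K - n) - 1) / 2 : ℕ) : ℤ))) : Matrix.specialUnitaryGroup (Fin 2) ℂ) : Matrix (Fin 2) (Fin 2) ℂ))
          * (∑ r : Fin (F.P K).d → Fin ((F.P K).L ^ (K - n)), ∑ s ∈ Finset.range ((F.P K).L ^ (K - n)),
              conjR (holT (unitsField (toUField W)) (Site.fibreSite 0 (K - n) c.src fun _ => ⟨0, pow_pos (F.P K).L_pos (K - n)⟩) (treeWord fun ν => ((r ν : ℕ) : ℤ))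
                  * holT (unitsField (toUField W)) (Site.fibreSite 0 (K - n) c.src r) (List.replicate s (c.dir, true)))
                (B ⟨(fun z : Site (F.P K) 0 => z.shift c.dir)^[s] (Site.fibreSite 0 (K - n) c.src r), c.dir⟩))
          * star (((holAt W (walk (embIter (K - n) c.src) (treeWord fun _ : Fin (F.P K).d => -((((F.P K).L ^ (K - n) - 1) / 2 : ℕ) : ℤ))) : Matrix.specialUnitaryGroup (Fin 2) ℂ) : Matrix (Fin 2) (Fin 2) ℂ)))‖ ^ 2 :=
      Finset.sum_congr rfl fun c _ => by rw [real_smul_eq_coe_smul, hscal]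
    rw [hconv]
    linarith [hGX]
  -- ===== (5)+(6) px17's R3′ door with hX in its letters (CF := ζ_X, K′ := K, Ce := θ_X, CG := 0, Elong := C_E·ℓ·G_W + θ_E·e·ℓ⁻¹·M, JVH := C_X·ℓ·G_W + η_X·ℓ·DIV) =====
  have hdoor := sum_normSq_centreDiff_le_of_rows (N := 2)
    (Averaging.iter (fun i => blockAvg (P := F.P K) (j := i) (expMeanLogSU (n := Fin 2))) (K - n) W) φ₀ (Λ (K - n)) (G (K - n)) (Q (K - n) D)
    (fun c => ((((F.P K).L : ℝ) ^ (K - n)) ^ (F.P K).d)⁻¹ • ((((holAt W (walk (embIter (K - n) c.src) (treeWord fun _ : Fin (F.P K).d => -((((F.P K).L ^ (K - n) - 1) / 2 : ℕ) : ℤ))) : Matrix.specialUnitaryGroup (Fin 2) ℂ) : Matrix (Fin 2) (Fin 2) ℂ))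
          * (∑ r : Fin (F.P K).d → Fin ((F.P K).L ^ (K - n)), ∑ s ∈ Finset.range ((F.P K).L ^ (K - n)),
              conjR (holT (unitsField (toUField W)) (Site.fibreSite 0 (K - n) c.src fun _ => ⟨0, pow_pos (F.P K).L_pos (K - n)⟩) (treeWord fun ν => ((r ν : ℕ) : ℤ))
                  * holT (unitsField (toUField W)) (Site.fibreSite 0 (K - n) c.src r) (List.replicate s (c.dir, true)))
                (B ⟨(fun z : Site (F.P K) 0 => z.shift c.dir)^[s] (Site.fibreSite 0 (K - n) c.src r), c.dir⟩))
          * star (((holAt W (walk (embIter (K - n) c.src) (treeWord fun _ : Fin (F.P K).d => -((((F.P K).L ^ (K - n) - 1) / 2 : ℕ) : ℤ))) : Matrix.specialUnitaryGroup (Fin 2) ℂ) : Matrix (Fin 2) (Fin 2) ℂ))))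
    FACE
    (CF := ζ_X) (θ := θ) (ℓ := (F.L : ℝ) ^ (K - n)) (K' := KD) (M := MD) (Ce := θ_X) (e := e) (CG := 0) (JVH := C_X * (F.L : ℝ) ^ (K - n) * GW + η_X * (F.L : ℝ) ^ (K - n) * DIV)
    hR2 hL hE (by
      have e1 : ζ_X / θ * (F.L : ℝ) ^ (K - n) * KD = (F.L : ℝ) ^ (K - n) * (ζ_X / θ) * KD := by ring
      linarith [hXb, e1])
  -- ===== (7) bookkeeping =====
  have h96 : 16 * ((F.P K).d : ℝ) * (2 : ℝ) * ∑ y : Site (F.P K) (K - n), ‖Λ (K - n) y‖ ^ 2 = 96 * ∑ y : Site (F.P K) (K - n), ‖Λ (K - n) y‖ ^ 2 := by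
    rw [hd]; norm_num
  have hΛv : 96 * ∑ y : Site (F.P K) (K - n), ‖Λ (K - n) y‖ ^ 2
      ≤ 19200 * (F.L : ℝ) ^ 4 * (F.L : ℝ) ^ (K - n) * CURL + 768000000000 * (F.L : ℝ) ^ 9 * e * ((F.L : ℝ) ^ (K - n))⁻¹ * MD := by
    have h1 := mul_le_mul_of_nonneg_left hΛb (by norm_num : (0 : ℝ) ≤ 96)
    have e2 : 96 * ((F.L : ℝ) ^ (K - n) * (100 * (2 : ℕ) * (F.L : ℝ) ^ 4 * CURL + 10 ^ 9 * (2 : ℕ) ^ 2 * (F.L : ℝ) ^ 9 * e * (((F.L : ℝ) ^ (K - n)) ^ 2)⁻¹ * MB))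
        = 19200 * (F.L : ℝ) ^ 4 * (F.L : ℝ) ^ (K - n) * CURL + 384000000000 * (F.L : ℝ) ^ 9 * e * ((F.L : ℝ) ^ (K - n))⁻¹ * MB := by
      push_cast
      field_simp
      ring
    rw [e2] at h1
    have h3 : 384000000000 * (F.L : ℝ) ^ 9 * e * ((F.L : ℝ) ^ (K - n))⁻¹ * MB ≤ 768000000000 * (F.L : ℝ) ^ 9 * e * ((F.L : ℝ) ^ (K - n))⁻¹ * MD := by
      have h0 : 0 ≤ 384000000000 * (F.L : ℝ) ^ 9 * e * ((F.L : ℝ) ^ (K - n))⁻¹ := by positivity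
      have := mul_le_mul_of_nonneg_left hBM h0
      linarith
    linarith
  simp only [Nat.cast_ofNat] at hdoor
  rw [h96] at hdoor
  -- freeze the `L`-polynomial constant as one atom for the linear bookkeeping
  set CC : ℝ := ((4770 * (F.L : ℝ) ^ 3) ^ 2 * ((5 * (F.L : ℝ)) ^ 2 / 2) ^ 2 / 4
              + (2 * (5 * (F.L : ℝ)) ^ 3 / ((F.L : ℝ) * ((F.L : ℝ) - 1) * ((F.L : ℝ) ^ 2 - 1)) + (2 * (5 * (F.L : ℝ)) + 2 * 3 + 1) ^ 2 / 2) ^ 2) with hCCdef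
  set ℓ : ℝ := (F.L : ℝ) ^ (K - n) with hℓdef
  set QD : ℝ := ∑ c : PBond (F.P K) (K - n), ‖Q (K - n) D c‖ ^ 2 with hQD
  set LΛ : ℝ := ∑ y : Site (F.P K) (K - n), ‖Λ (K - n) y‖ ^ 2 with hLΛ
  linarith only [hdoor, hΛv, hq]

end Summit.QuantumFields.YangMills.Theorems.Prop7RowPOfFaceFluxRowsOfHE

end
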